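import Summits.CriticalPhenomena.CardyFormulaZ2.Theorems.CardyBoundaryCoulombGasBoundaryDefectGaussianRStubTransportPathsPart10
import Summits.CriticalPhenomena.CardyFormulaZ2.Theorems.CardyBoundaryCoulombGasBoundaryDefectGaussianRStubTransportPathsPart11

/-!
# Stub `stub_transportPaths` of line `rainbow-monomials-in-excursion-kernels` — Part 23:
# the schedule with bounded lengths; small identities along an edge
# (crux `CardyBoundaryCoulombGas.BoundaryDefectGaussianR`, stmt-CriticalPhenomena-14132)

* `tp_schedule''` — movers one at a time (Parts 15, 21) where each mover's transport path has a
  BOUNDED rather than exact length (as produced by `tp_mover_fwd/bwd`, Part 22): the total path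
  has length `≤ Σ bounds` and `≤ Σ` jumps.
* `tp_inside_dist` — a parameter strictly inside an edge is at positive distance from both
  corners along the edge; `tp_rail_threshold` — the rail threshold `im (w (-i)^e)` is the same at
  every point `w` of the edge (so consecutive rails meet at the lattice corner of Part 17).
All [folklore].
-/

noncomputable section

open Set Filter Metric Topology
open Literature.Probability.RandomPlanarGeometry
open Summit.CriticalPhenomena.CardyFormulaZ2.Cruxes.RectilinearCardy.ExcursionKernelCovariance

namespace Summit.CriticalPhenomena.CardyFormulaZ2.Cruxes.BoundaryDefectGaussianR.RainbowMonomialsInExcursionKernels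

open Literature.Probability.LatticeModels Literature.Probability.LatticeModels.CollarLegModel

/-- **The schedule with bounded lengths.** [folklore] -/
theorem tp_schedule'' (k : ℕ) (L : Fin k → ℕ) (j : Fin k) (V : Finset (ℤ × ℤ))
    (Fl FlR : ℤ × ℤ → Prop) (Sep JumpOK : ℤ × ℤ → ℤ × ℤ → Prop)
    (hSepne : ∀ u v, Sep u v → u ≠ v)
    (init fin : Fin k → ℤ × ℤ) (B jmp : Fin k → ℕ) (ord : List (Fin k))
    (hFl0 : ∀ i, Fl (init i)) (hSep0 : ∀ i₁ i₂ : Fin k, i₁ ≠ i₂ → Sep (init i₁) (init i₂))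
    (hmover : ∀ (pre post : List (Fin k)) (m : Fin k), ord = pre ++ m :: post →
      LegInsertionData.IsAdmissible
      (⟨(Finset.univ.erase j).image ((fun i => if i ∈ pre then fin i else init i)), fun v ↦ ∑ b ∈ (Finset.univ.erase j).filter
        (fun b ↦ ((fun i => if i ∈ pre then fin i else init i)) b = v), L b, ((fun i => if i ∈ pre then fin i else init i)) j⟩ : LegInsertionData) V →
      ∃ T : ℕ, T ≤ B m ∧
      (∃ (q : ℕ → Fin k → ℤ × ℤ) (σ' : ℕ → Bool), q 0 = (fun i => if i ∈ pre then fin i else init i) ∧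
      q (T) = (fun i => if i ∈ pre ++ [m] then fin i else init i) ∧
      ((Finset.range (T)).filter (fun t => σ' t = false)).card ≤ jmp m ∧
      (∀ t, t ≤ T → (Function.Injective (q t) ∧
        LegInsertionData.IsAdmissible
          (⟨(Finset.univ.erase j).image (q t), fun v ↦ ∑ b ∈ (Finset.univ.erase j).filter
            (fun b ↦ (q t) b = v), L b, (q t) j⟩ : LegInsertionData) V ∧
        (∀ i, Fl (q t i)) ∧ (∀ i₁ i₂ : Fin k, i₁ ≠ i₂ → Sep (q t i₁) (q t i₂)))) ∧
      (∀ t, t < T →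
        (σ' t = true → ∃ (i : Fin k) (τ : ℤ × ℤ), (τ = (1, 0) ∨ τ = (-1, 0) ∨ τ = (0, 1) ∨
          τ = (0, -1)) ∧ q (t + 1) = Function.update (q t) i (q t i + τ)) ∧
        (σ' t = false → ∃ (i : Fin k) (q' : ℤ × ℤ), q (t + 1) = Function.update (q t) i q' ∧
          (∀ i', i' ≠ i → FlR (q t i')) ∧ JumpOK (q t i) q'))) ∧
      LegInsertionData.IsAdmissible
      (⟨(Finset.univ.erase j).image ((fun i => if i ∈ pre ++ [m] then fin i else init i)), fun v ↦ ∑ b ∈ (Finset.univ.erase j).filter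
        (fun b ↦ ((fun i => if i ∈ pre ++ [m] then fin i else init i)) b = v), L b, ((fun i => if i ∈ pre ++ [m] then fin i else init i)) j⟩ : LegInsertionData) V)
    (hadm : LegInsertionData.IsAdmissible
      (⟨(Finset.univ.erase j).image (init), fun v ↦ ∑ b ∈ (Finset.univ.erase j).filter
        (fun b ↦ (init) b = v), L b, (init) j⟩ : LegInsertionData) V) :
    ∃ T : ℕ, T ≤ (ord.map B).sum ∧
    (∃ (q : ℕ → Fin k → ℤ × ℤ) (σ' : ℕ → Bool), q 0 = init ∧
      q (T) = (fun i => if i ∈ ord then fin i else init i) ∧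
      ((Finset.range (T)).filter (fun t => σ' t = false)).card ≤ (ord.map jmp).sum ∧
      (∀ t, t ≤ T → (Function.Injective (q t) ∧
        LegInsertionData.IsAdmissible
          (⟨(Finset.univ.erase j).image (q t), fun v ↦ ∑ b ∈ (Finset.univ.erase j).filter
            (fun b ↦ (q t) b = v), L b, (q t) j⟩ : LegInsertionData) V ∧
        (∀ i, Fl (q t i)) ∧ (∀ i₁ i₂ : Fin k, i₁ ≠ i₂ → Sep (q t i₁) (q t i₂)))) ∧
      (∀ t, t < T →
        (σ' t = true → ∃ (i : Fin k) (τ : ℤ × ℤ), (τ = (1, 0) ∨ τ = (-1, 0) ∨ τ = (0, 1) ∨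
          τ = (0, -1)) ∧ q (t + 1) = Function.update (q t) i (q t i + τ)) ∧
        (σ' t = false → ∃ (i : Fin k) (q' : ℤ × ℤ), q (t + 1) = Function.update (q t) i q' ∧
          (∀ i', i' ≠ i → FlR (q t i')) ∧ JumpOK (q t i) q'))) := by
  classical
  set Good : (Fin k → ℤ × ℤ) → Prop := fun Q => Function.Injective Q ∧
    LegInsertionData.IsAdmissible
      (⟨(Finset.univ.erase j).image Q, fun v ↦ ∑ b ∈ (Finset.univ.erase j).filter
        (fun b ↦ Q b = v), L b, Q j⟩ : LegInsertionData) V ∧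
    (∀ i, Fl (Q i)) ∧ (∀ i₁ i₂ : Fin k, i₁ ≠ i₂ → Sep (Q i₁) (Q i₂)) with hGood
  set Step : (Fin k → ℤ × ℤ) → (Fin k → ℤ × ℤ) → Bool → Prop := fun Q Q' b =>
    (b = true → ∃ (i : Fin k) (τ : ℤ × ℤ), (τ = (1, 0) ∨ τ = (-1, 0) ∨ τ = (0, 1) ∨
      τ = (0, -1)) ∧ Q' = Function.update Q i (Q i + τ)) ∧
    (b = false → ∃ (i : Fin k) (q' : ℤ × ℤ), Q' = Function.update Q i q' ∧
      (∀ i', i' ≠ i → FlR (Q i')) ∧ JumpOK (Q i) q') with hStep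
  set cfg : List (Fin k) → Fin k → ℤ × ℤ := fun pre i => if i ∈ pre then fin i else init i
    with hcfg
  have key : ∀ (post pre : List (Fin k)), ord = pre ++ post →
      LegInsertionData.IsAdmissible
        (⟨(Finset.univ.erase j).image (cfg pre), fun v ↦ ∑ b ∈ (Finset.univ.erase j).filter
          (fun b ↦ (cfg pre) b = v), L b, (cfg pre) j⟩ : LegInsertionData) V →
      (∃ T : ℕ, T ≤ (pre.map B).sum ∧ ∃ (q : ℕ → Fin k → ℤ × ℤ) (σ' : ℕ → Bool), q 0 = init ∧
        q T = cfg pre ∧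
        ((Finset.range T).filter (fun t => σ' t = false)).card ≤ (pre.map jmp).sum ∧
        (∀ t, t ≤ T → Good (q t)) ∧ (∀ t, t < T → Step (q t) (q (t + 1)) (σ' t))) →
      ∃ T : ℕ, T ≤ ((pre ++ post).map B).sum ∧ ∃ (q : ℕ → Fin k → ℤ × ℤ) (σ' : ℕ → Bool),
        q 0 = init ∧ q T = cfg (pre ++ post) ∧
        ((Finset.range T).filter (fun t => σ' t = false)).card ≤ ((pre ++ post).map jmp).sum ∧
        (∀ t, t ≤ T → Good (q t)) ∧ (∀ t, t < T → Step (q t) (q (t + 1)) (σ' t)) := by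
    intro post
    induction post with
    | nil => intro pre _ _ hpath; simpa using hpath
    | cons m post ih =>
      intro pre hord hadmpre hpath
      obtain ⟨T₂, hT₂, hone, hadm'⟩ := hmover pre post m hord hadmpre
      obtain ⟨T₁, hT₁, hpath₁⟩ := hpath
      have htrans := tp_path_trans Good Step hpath₁ hone
      have e : pre ++ m :: post = (pre ++ [m]) ++ post := by simp
      rw [e]
      refine ih (pre ++ [m]) (by rw [hord, e]) hadm' ?_
      obtain ⟨q, σ', hq0, hqT, hqc, hqg, hqs⟩ := htrans
      have hsum : ((pre ++ [m]).map B).sum = (pre.map B).sum + B m := by simp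
      have hsum' : ((pre ++ [m]).map jmp).sum = (pre.map jmp).sum + jmp m := by simp
      exact ⟨T₁ + T₂, by rw [hsum]; omega, q, σ', hq0, hqT, by rw [hsum']; exact hqc, hqg, hqs⟩
  have hcfg0 : cfg [] = init := by funext i; simp [hcfg]
  have hstart : ∃ T : ℕ, T ≤ (([] : List (Fin k)).map B).sum ∧
      ∃ (q : ℕ → Fin k → ℤ × ℤ) (σ' : ℕ → Bool), q 0 = init ∧ q T = cfg [] ∧
      ((Finset.range T).filter (fun t => σ' t = false)).card ≤ (([] : List (Fin k)).map jmp).sum ∧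
      (∀ t, t ≤ T → Good (q t)) ∧ (∀ t, t < T → Step (q t) (q (t + 1)) (σ' t)) := by
    have hinj : Function.Injective init := fun i₁ i₂ h => by
      by_contra hne; exact hSepne _ _ (hSep0 i₁ i₂ hne) h
    refine ⟨0, by simp, ?_⟩
    rw [hcfg0]
    simpa using tp_path_refl Good Step (P := init) ⟨hinj, hadm, hFl0, hSep0⟩
  have hres := key ord [] (by simp) (by rw [hcfg0]; exact hadm) hstart
  simp only [List.nil_append] at hres
  exact hres

/-- **Inside an edge.** A parameter strictly inside the edge `z` is at positive distance from
both corners, the two distances adding up to the edge length. [folklore] -/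
theorem tp_inside_dist (D : JordanDomain) {c : ℤ → ℝ} {a : ℤ → ℕ} (hcmono : StrictMono c)
    (hdir : ∀ z, ∀ t ∈ Icc (c z) (c (z + 1)), D.boundary t =
      D.boundary (c z) + ((‖D.boundary t - D.boundary (c z)‖ : ℝ) : ℂ) * Complex.I ^ (a z))
    (hmono : ∀ z, StrictMonoOn (fun t => ‖D.boundary t - D.boundary (c z)‖) (Icc (c z) (c (z + 1))))
    (z : ℤ) {t : ℝ} (ht : t ∈ Ioo (c z) (c (z + 1))) :
    0 < ‖D.boundary t - D.boundary (c z)‖ ∧ 0 < ‖D.boundary (c (z + 1)) - D.boundary t‖ ∧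
    ‖D.boundary (c (z + 1)) - D.boundary t‖ =
      ‖D.boundary (c (z + 1)) - D.boundary (c z)‖ - ‖D.boundary t - D.boundary (c z)‖ := by
  have hcz : c z ≤ c (z + 1) := (hcmono (by omega : z < z + 1)).le
  have h1 := hmono z ⟨le_rfl, hcz⟩ ⟨ht.1.le, ht.2.le⟩ ht.1
  have h2 := hmono z ⟨ht.1.le, ht.2.le⟩ ⟨hcz, le_rfl⟩ ht.2
  simp only [sub_self, norm_zero] at h1
  have e : D.boundary (c (z + 1)) - D.boundary t =
      (((‖D.boundary (c (z + 1)) - D.boundary (c z)‖ - ‖D.boundary t - D.boundary (c z)‖ : ℝ) : ℂ)) *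
        Complex.I ^ (a z) := by
    rw [hdir z (c (z + 1)) ⟨hcz, le_rfl⟩, hdir z t ⟨ht.1.le, ht.2.le⟩]
    simp only [add_sub_cancel_left, norm_mul, norm_pow, Complex.norm_I, one_pow, mul_one,
      Complex.norm_real, Real.norm_eq_abs, abs_norm]
    push_cast; ring
  have hn : ‖D.boundary (c (z + 1)) - D.boundary t‖ =
      ‖D.boundary (c (z + 1)) - D.boundary (c z)‖ - ‖D.boundary t - D.boundary (c z)‖ := by
    rw [e, norm_mul, norm_pow, Complex.norm_I, one_pow, mul_one, Complex.norm_real,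
      Real.norm_eq_abs, abs_of_nonneg (by simpa using h2.le)]
  exact ⟨h1, by rw [hn]; simpa using h2, hn⟩

/-- **The rail threshold is constant along an edge**: `im ((P + s i^e) (-i)^e) = im (P (-i)^e)`
and the along-coordinate moves by `s`. [folklore] -/
theorem tp_rail_threshold (P : ℂ) (s : ℝ) (e : ℕ) :
    ((P + (s : ℂ) * Complex.I ^ e) * (-Complex.I) ^ e).im = (P * (-Complex.I) ^ e).im ∧
    ((P + (s : ℂ) * Complex.I ^ e) * (-Complex.I) ^ e).re = (P * (-Complex.I) ^ e).re + s := by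
  rw [add_mul, mul_assoc, I_pow_mul_neg_I_pow, mul_one]
  simp

/-- **Registered sub-goal `s7_insideDist` of stub `stub_transportPaths`** (inside an edge, one-line
form of `tp_inside_dist`). [folklore] -/
theorem s7_insideDist : ∀ (D : Literature.Probability.RandomPlanarGeometry.JordanDomain) (c : ℤ → ℝ) (a : ℤ → ℕ), (StrictMono c) → (∀ z, ∀ t ∈ Set.Icc (c z) (c (z + 1)), D.boundary t = D.boundary (c z) + ((‖D.boundary t - D.boundary (c z)‖ : ℝ) : ℂ) * Complex.I ^ (a z)) → (∀ z, StrictMonoOn (fun t => ‖D.boundary t - D.boundary (c z)‖) (Set.Icc (c z) (c (z + 1)))) → ∀ (z : ℤ) (t : ℝ), (t ∈ Set.Ioo (c z) (c (z + 1))) → 0 < ‖D.boundary t - D.boundary (c z)‖ ∧ 0 < ‖D.boundary (c (z + 1)) - D.boundary t‖ ∧ ‖D.boundary (c (z + 1)) - D.boundary t‖ = ‖D.boundary (c (z + 1)) - D.boundary (c z)‖ - ‖D.boundary t - D.boundary (c z)‖ :=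
  fun D _ _ hcmono hdir hmono z _ ht => tp_inside_dist D hcmono hdir hmono z ht

end Summit.CriticalPhenomena.CardyFormulaZ2.Cruxes.BoundaryDefectGaussianR.RainbowMonomialsInExcursionKernels

end
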